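import Summits.QuantumFields.YangMills.Theorems.IR.VolumeMonotoneDefs
import Summits.QuantumFields.YangMills.Theorems.IR.VolumeMonotoneTraceExcessFloor
import HarnessLib

/-!
# Crux `IR` (stmt-QuantumFields-19354), line `ym-ir7-volume-monotone-gap` (ideator ym-ir-idea-7) — part 3:
# the input T-GAP-FINITE-sc on the engine window and the rung MONO-sc-window, PROVED

Helper module for item `stmt-QuantumFields-19354` (`--supports … --as helper`; it closes no item — `IR` stays open).  Pooled prover
ym-ir-line-pool-p3 (g5).  Over the tree constants of `Theorems/IR/VolumeMonotoneDefs.lean` (the line's vocabulary VERBATIM) and the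
volume-uniform strong-coupling transfer-gap floor `traceExcess_floor_strongCoupling` (`Theorems/IR/VolumeMonotoneTraceExcessFloor.lean`):

* `traceExcessFloorSCWindow_holds : TraceExcessFloorSCWindow` — the line's named input T-GAP-FINITE-sc («`e^{−M(m+2)} ≤ traceExcess r.ρ β (2S+1) (m+2)`
  volume-uniformly on compact strong-coupling windows») on the ENGINE window `[β₁, βF]`, `βF = min β₀ r_ρ`, with `M = log(1/min(c₁β₁⁴, ½))`;
* `coldPressureRate_le_strongCoupling` — the β-explicit CEILING on admissible cold-pressure rates: on the window, `ColdPressureBound … g C₀` with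
  `1 ≤ C₀` forces `g ≤ log(1/(c₁β⁴))` (census format note for pincer-currency rungs on `(0, β_D]`, as a kernel fact);
* `monoWindow_of_traceExcessFloorWindow : TraceExcessFloorSCWindow → VolumeMonotoneStrongCouplingWindow` — the skeleton's real proof
  `monoWindow_of_traceExcessFloor` re-run from the window input (the floor caps every admissible cold-pressure rate, `g ≤ M`, by the seam
  `rate_le_of_traceExcessFloor`; the tree's volume-uniform rate-`1/8` strong-coupling cold trace bound on the larger torus; rate and constant
  monotonicity; `βD := βF`);
* `volumeMonotoneStrongCouplingWindow_holds : VolumeMonotoneStrongCouplingWindow` — **the rung MONO-sc-window of the line is a THEOREM**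
  (the skeleton's `rung_monoStrongCouplingWindow`, so far derived from the sorried input `stub_input_traceExcessFloor`, is closed by name once the
  skeleton re-bases on `VolumeMonotoneDefs`).

What stays open on this line: the typed input `TraceExcessFloorSC` on the FULL window `[β₁, strongCouplingRadius r.ρ]` (the floor engine's cap
`β₀` may be smaller), the `(0, β_D]`-uniform rung `VolumeMonotoneStrongCoupling` (both of its inputs are now in the tree — (a) the rate-tracking
cold-pressure bound `coldPressureBound_strongCoupling_log`, (b) the β-explicit ceiling `λ₁/λ₀ ≥ c₁β⁴` of part 2b — but (b)'s volume floor
`S₀(β₁) = O(log(1/β₁))` is not β-uniform: a β⁴ law on ASYMMETRIC tori `N³ × T` would remove it), and the loads FV / MONO / `IRnsc`.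

HONEST FRAMING: a FORMAT rung inside `IR`'s known (strong-coupling) regime — not a witness of weakness; nothing here proves `BalabanLadder.IR`,
a weak-coupling lattice gap, or the Yang–Mills mass gap (Clay); R4 of the ladder closes only the conditional finite-𝕋⁴ rung `BalabanLadder.UV`.
-/

set_option autoImplicit false

noncomputable section

open Filter Topology MeasureTheory
open Literature.MathematicalPhysics.QuantumFieldTheory Literature.MathematicalPhysics.QuantumLattice
open Literature.MathematicalPhysics.QuantumFieldTheory.Balaban1983to89.Sufficient (ColdPressureBound ColdTraceBound
  coldPressureBound_of_coldTraceBound)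
open Literature.MathematicalPhysics.QuantumFieldTheory.Balaban1983to89.Missing (ColdFreeEnergyBound
  strongCouplingRadius strongCouplingRadius_pos coldFreeEnergyBound_of_strongCoupling coldTraceBound_of_coldFreeEnergyBound)

namespace Summit.QuantumFields.YangMills.Cruxes.IR.VolumeMonotone

/-- **Input T-GAP-FINITE-sc on the engine window — PROVED** (`βF`, `c₁` from `traceExcess_floor_strongCoupling`; on `[β₁, βF]` take
`M := log(1/q)`, `q := min(c₁β₁⁴, ½)`, so that `e^{−M(m+2)} = q^{m+2} ≤ (c₁β⁴)^{m+2} ≤ traceExcess`). -/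
theorem traceExcessFloorSCWindow_holds : TraceExcessFloorSCWindow := by
  intro G _ _ _ _ hG _hsc
  letI : MeasurableSpace G := borel G
  haveI : BorelSpace G := ⟨rfl⟩
  intro r
  obtain ⟨βF, c₁, hβF, hβFr, hc₁, h⟩ := traceExcess_floor_strongCoupling G hG r
  refine ⟨βF, hβF, hβFr, fun β₁ hβ₁ hβ₁F => ?_⟩
  obtain ⟨S₀, hS₀⟩ := h β₁ hβ₁ hβ₁F
  set q : ℝ := min (c₁ * β₁ ^ 4) (1 / 2) with hq
  have hq0 : 0 < q := lt_min (by positivity) (by norm_num)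
  have hq1 : q < 1 := lt_of_le_of_lt (min_le_right _ _) (by norm_num)
  refine ⟨-Real.log q, by rw [neg_pos]; exact Real.log_neg hq0 hq1, S₀, 0, fun β hβ1 hβF' S hS m _ => ?_⟩
  have hβ0 : 0 ≤ β₁ := hβ₁.le
  have hqβ : q ≤ c₁ * β ^ 4 :=
    (min_le_left _ _).trans (mul_le_mul_of_nonneg_left (pow_le_pow_left₀ hβ0 hβ1 4) hc₁.le)
  have hexp : Real.exp (-(-Real.log q * ((m + 2 : ℕ) : ℝ))) = q ^ (m + 2) := by
    rw [show -(-Real.log q * ((m + 2 : ℕ) : ℝ)) = ((m + 2 : ℕ) : ℝ) * Real.log q by ring, Real.exp_nat_mul, Real.exp_log hq0]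
  rw [hexp]
  exact (pow_le_pow_left₀ hq0.le hqβ _).trans (hS₀ β hβ1 hβF' S hS m)


/-- **The β-explicit CEILING on admissible cold-pressure rates at strong coupling** (census FORMAT note for pincer-currency rungs on `(0, β_D]`:
«hypotheses `ColdPressureBound … g C₀` with `1 ≤ C₀` admit any `g ≤ m(β, S)`»): on the engine window and above the volume floor `S₀(β₁)`, every
cold trace bound with `1 ≤ C₀` has rate `g ≤ log(1/(c₁β⁴)) = 4 log(1/β) + log(1/c₁)` (seam `rate_le_of_traceExcessFloor` + the floor
`traceExcess_floor_strongCoupling`). -/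
theorem coldPressureRate_le_strongCoupling :
    ∀ (G : Type) [Group G] [TopologicalSpace G] [IsTopologicalGroup G] [CompactSpace G],
      IsCompactSimpleLieGroup G →
      letI : MeasurableSpace G := borel G; haveI : BorelSpace G := ⟨rfl⟩;
      ∀ (r : LatticeRep G), ∃ βF c₁ : ℝ, 0 < βF ∧ βF ≤ strongCouplingRadius r.ρ ∧ 0 < c₁ ∧
        ∀ β₁ : ℝ, 0 < β₁ → β₁ ≤ βF → ∃ S₀ : ℕ, ∀ β : ℝ, β₁ ≤ β → β ≤ βF → ∀ S : ℕ, S₀ ≤ S →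
          ∀ g C₀ : ℝ, 1 ≤ C₀ → ColdPressureBound r.ρ β S g C₀ → g ≤ -Real.log (c₁ * β ^ 4) := by
  intro G _ _ _ _ hG
  letI : MeasurableSpace G := borel G
  haveI : BorelSpace G := ⟨rfl⟩
  intro r
  obtain ⟨βF, c₁, hβF, hβFr, hc₁, h⟩ := traceExcess_floor_strongCoupling G hG r
  refine ⟨βF, c₁, hβF, hβFr, hc₁, fun β₁ hβ₁ hβ₁F => ?_⟩
  obtain ⟨S₀, hS₀⟩ := h β₁ hβ₁ hβ₁F
  refine ⟨S₀, fun β hβ1 hβF' S hS g C₀ hC₀ hcp => ?_⟩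
  have hβ : 0 < β := lt_of_lt_of_le hβ₁ hβ1
  have hq0 : 0 < c₁ * β ^ 4 := by positivity
  refine rate_le_of_traceExcessFloor (t₀ := 0) hcp hC₀ fun m _ => ?_
  have hexp : Real.exp (-(-Real.log (c₁ * β ^ 4) * ((m + 2 : ℕ) : ℝ))) = (c₁ * β ^ 4) ^ (m + 2) := by
    rw [show -(-Real.log (c₁ * β ^ 4) * ((m + 2 : ℕ) : ℝ)) = ((m + 2 : ℕ) : ℝ) * Real.log (c₁ * β ^ 4) by ring,
      Real.exp_nat_mul, Real.exp_log hq0]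
  rw [hexp]
  exact hS₀ β hβ1 hβF' S hS m

/-- **`TraceExcessFloorSCWindow ⇒ VolumeMonotoneStrongCouplingWindow`** (the skeleton's `monoWindow_of_traceExcessFloor`, re-run from the window
input with `βD := βF`): on `[β₁, βF]` the floor `e^{−M(m+2)} ≤ traceExcess` and a cold trace bound with `1 ≤ C₀` force `g ≤ M`
(`rate_le_of_traceExcessFloor`); the tree's volume-uniform strong-coupling bound gives the cold trace bound at rate `1/8` with a universal constant
`A` on EVERY torus; `θ := 1/(8·max M 1)`, `K := max 1 A` conclude by rate and constant monotonicity. -/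
theorem monoWindow_of_traceExcessFloorWindow (hF : TraceExcessFloorSCWindow) : VolumeMonotoneStrongCouplingWindow := by
  intro G _ _ _ _ hG hsc
  letI : MeasurableSpace G := borel G
  haveI : BorelSpace G := ⟨rfl⟩
  intro r
  haveI : SecondCountableTopology G :=
    (r.continuous.isClosedEmbedding r.injective).isEmbedding.secondCountableTopology
  obtain ⟨βF, hβF, hβFr, hwin⟩ := hF G hG hsc r
  refine ⟨βF, hβF, fun β₁ hβ₁ hβ₁F => ?_⟩
  obtain ⟨M, hM, S₀, t₀, hfloor⟩ := hwin β₁ hβ₁ hβ₁F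
  -- the universal strong-coupling constant of the volume-uniform rate-`1/8` cold trace bound
  set Kst : ℝ := 48 * Real.exp 1 with hKst
  set A : ℝ := 3072 * Kst / (1 / 4 : ℝ) ^ 3 * Real.exp (3072 * Kst / (1 / 4 : ℝ) ^ 3) with hAdef
  have hK0 : 0 ≤ Kst := by positivity
  have hA0 : 0 ≤ A := by positivity
  have hmax : 0 < max M 1 := lt_of_lt_of_le one_pos (le_max_right _ _)
  refine ⟨1 / (8 * max M 1), by positivity, ?_, max 1 A, le_max_left _ _, S₀, ?_⟩
  · rw [div_le_one (by positivity)]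
    nlinarith [le_max_right M 1]
  intro β hβ1 hβD S S' hS hSS' g C₀ hg hC₀ hcp
  have hβ0 : 0 ≤ β := le_trans hβ₁.le hβ1
  have hβr : β ≤ strongCouplingRadius r.ρ := hβD.trans hβFr
  -- Step 1: the floor caps every admissible rate: `g ≤ M`.
  have hgM : g ≤ M := rate_le_of_traceExcessFloor hcp hC₀ (fun m hm => hfloor β hβ1 hβD S hS m hm)
  -- Step 2: the tree's volume-uniform strong-coupling bound on the LARGER torus, rate `1/8`, constant `A`.
  have hSC : ColdPressureBound r.ρ β S' (1 / ((8 : ℕ) : ℝ)) A := by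
    have hFE : ColdFreeEnergyBound r.ρ β (2 * S' + 1) (1 / 4) Kst 0 :=
      coldFreeEnergyBound_of_strongCoupling r.ρ r.continuous r.mem_unitary hβ0 hβr (2 * S' + 1)
    have hT : ColdTraceBound r.ρ β S' (1 / 4 / 2) A :=
      coldTraceBound_of_coldFreeEnergyBound r.ρ (by norm_num) hK0 (by omega) hFE
    have hT' : ColdTraceBound r.ρ β S' (1 / ((8 : ℕ) : ℝ)) A := by
      have h8 : (1 / 4 / 2 : ℝ) = 1 / ((8 : ℕ) : ℝ) := by norm_num
      rw [← h8]
      exact hT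
    have h := coldPressureBound_of_coldTraceBound hT' hA0 (Nat.zero_le S')
    have h1 : A / ((2 * 0 + 1 : ℕ) : ℝ) ^ 3 = A := by norm_num
    rw [h1] at h
    exact h
  -- Step 3: rate and constant monotonicity (a smaller rate and a larger constant are weaker cold trace bounds).
  have hrate : 1 / (8 * max M 1) * g ≤ 1 / ((8 : ℕ) : ℝ) := by
    have hgmax : g ≤ max M 1 := hgM.trans (le_max_left _ _)
    rw [div_mul_eq_mul_div, one_mul, div_le_div_iff₀ (by positivity) (by positivity)]
    push_cast
    nlinarith
  have hconst : A ≤ max 1 A * C₀ := by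
    have h1 : A ≤ max 1 A := le_max_right _ _
    have h2 : max 1 A ≤ max 1 A * C₀ := le_mul_of_one_le_right (le_trans zero_le_one (le_max_left _ _)) hC₀
    exact h1.trans h2
  have hmono : ColdPressureBound r.ρ β S' (1 / (8 * max M 1) * g) A := by
    intro m hm
    refine (hSC m hm).trans ?_
    have hV : 0 ≤ A * ((2 * S' + 1 : ℕ) : ℝ) ^ 3 := by positivity
    refine mul_le_mul_of_nonneg_left (Real.exp_le_exp.2 ?_) hV
    have hm0 : (0 : ℝ) ≤ ((m + 2 : ℕ) : ℝ) := Nat.cast_nonneg _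
    nlinarith
  exact coldPressureBound_mono_const hmono hconst

/-- **Rung MONO-sc-window — PROVED** (the line's `rung_monoStrongCouplingWindow`, now with no open input): the MONO format on compact
strong-coupling windows `[β₁, β_D]` holds for every compact simple simply-connected `G` and every `LatticeRep r`. -/
theorem volumeMonotoneStrongCouplingWindow_holds : VolumeMonotoneStrongCouplingWindow :=
  monoWindow_of_traceExcessFloorWindow traceExcessFloorSCWindow_holds

end Summit.QuantumFields.YangMills.Cruxes.IR.VolumeMonotone

end
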